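import Mathlib.Analysis.Normed.Module.Alternating.Basic
import Mathlib.Analysis.Normed.Operator.Bilinear
import Mathlib.Analysis.Complex.Basic
import Mathlib.Analysis.Normed.Module.FiniteDimension
import Mathlib.Topology.Algebra.Module.FiniteDimension
import Mathlib.LinearAlgebra.Complex.FiniteDimensional
import Mathlib.LinearAlgebra.Dual.Lemmas
import Mathlib.LinearAlgebra.FiniteDimensional.Lemmas
import HarnessLib

/-!
# The real pairing `a ↦ Re ω(a, ·)` of a complex-valued `2`-form; non-degeneracy of holomorphic
# symplectic forms in complex dimension `2`

Topic `Literature/Geometry/Kaehler` (linear algebra of `(2,0)`-forms). For a real normed space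
`E` and a continuous alternating `2`-form `ω : E [⋀^Fin 2]→L[ℝ] ℂ` we DEFINE the continuous
linear maps

* `rePairing ω : E →L[ℝ] E →L[ℝ] ℝ`, `a ↦ (b ↦ Re ω(a, b))`, and
* `imPairing ω : E →L[ℝ] E →L[ℝ] ℝ`, `a ↦ (b ↦ Im ω(a, b))`

(the real and imaginary parts of the interior product `a ↦ ι_a ω`, bounded by `‖ω‖`), together
with the bundled dependence on the form `rePairingL`, `imPairingL` (continuous linear of norm
`≤ 1`), and PROVE, for `ω = g|_ℝ` the real form underlying a `ℂ`-bilinear alternating form `g` on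
a complex normed space (a form of type `(2,0)`, e.g. a holomorphic `2`-form at a point;
D. Huybrechts, *Complex Geometry* (2005), §1.2 and Def. 2.2.14; C. Voisin, *Hodge Theory I*
(2002), §2.3.1):

* `rePairing_restrictScalars_I_smul`, `…_I_smul_right` — `Re g(ia, b) = Re g(a, ib) = -Im g(a, b)`;
* `apply_ne_zero_of_finrank_eq_two` — **a non-zero `(2,0)`-form on a complex plane is
  non-degenerate**: if `dim_ℂ E = 2` and `g ≠ 0` then for every `a ≠ 0` there is `b` with
  `g(a, b) ≠ 0` (`Λ²(ℂ²)^* ≅ ℂ`: a `2`-form vanishing on one pair of independent vectors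
  vanishes; Huybrechts, *Lectures on K3 Surfaces* (2016), Ch. 3 §1: a trivialising section of
  `K_X = Ω²_X` of a surface is a holomorphic symplectic form);
* `injective_rePairing_restrictScalars`, `isInvertible_rePairing_restrictScalars` — hence the
  real pairing `a ↦ Re g(a, ·) : E → E^*` is injective and (dimension count) invertible: every
  real covector `l` is `Re g(v, ·)` for a unique vector `v`, the **`g`-dual** of `l`
  (`rePairing_inverse_apply`); `rePairing_inverse_neg_imPairing`: the `g`-dual of `-Im g(a, ·)`
  is `ia`;
* `linearIndependent_of_apply_pair_ne_zero` — `a, ia, b, ib` are `ℝ`-independent when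
  `g(a, b) ≠ 0`.

Written for the fact seat of `Literature.AlgebraicGeometry.Surfaces.K3_even_intersectionForm`
(the almost-framing of a K3 surface by `g`-duals of differentials). No named facts.

## References

* D. Huybrechts, *Complex Geometry. An Introduction*, Springer 2005, §1.2, Def. 2.2.14.
  [Huybrechts2005]
* D. Huybrechts, *Lectures on K3 Surfaces*, CUP 2016, Ch. 1 Def. 1.1 and Ch. 3 §1.
  [Huybrechts2016K3]
* C. Voisin, *Hodge Theory and Complex Algebraic Geometry I*, CUP 2002, §2.3.1. [VoisinHodgeI2002]
-/

noncomputable section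

open Module

namespace Literature.Geometry.Kaehler

/-! ### The real and imaginary pairings of a complex-valued real `2`-form -/

section Real

variable {E : Type*} [NormedAddCommGroup E] [NormedSpace ℝ E]
  {F : Type*} [NormedAddCommGroup F] [NormedSpace ℝ F]

/-- Antisymmetry of a `2`-form on the standard arguments: `ω(b, a) = -ω(a, b)`. [folklore] -/
theorem apply_pair_swap (ω : E [⋀^Fin 2]→L[ℝ] F) (a b : E) : ω ![b, a] = -ω ![a, b] := by
  have h := ω.toAlternatingMap.map_swap (v := ![a, b]) (i := 0) (j := 1) (by decide)
  have hv : ((![a, b] : Fin 2 → E) ∘ Equiv.swap (0 : Fin 2) 1) = ![b, a] := by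
    funext i; fin_cases i <;> rfl
  rw [hv] at h
  exact h

/-- A `2`-form vanishes on the diagonal: `ω(a, a) = 0`. [folklore] -/
theorem apply_pair_self (ω : E [⋀^Fin 2]→L[ℝ] F) (a : E) : ω ![a, a] = 0 :=
  ω.map_eq_zero_of_eq ![a, a] (i := 0) (j := 1) rfl (by decide)

/-- Additivity in the first slot. [folklore] -/
theorem apply_pair_add_left (ω : E [⋀^Fin 2]→L[ℝ] F) (a a' b : E) :
    ω ![a + a', b] = ω ![a, b] + ω ![a', b] :=
  ω.vecCons_add ![b] a a'

/-- Homogeneity in the first slot. [folklore] -/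
theorem apply_pair_smul_left (ω : E [⋀^Fin 2]→L[ℝ] F) (c : ℝ) (a b : E) :
    ω ![c • a, b] = c • ω ![a, b] :=
  ω.vecCons_smul ![b] c a

/-- Additivity in the second slot. [folklore] -/
theorem apply_pair_add_right (ω : E [⋀^Fin 2]→L[ℝ] F) (a b b' : E) :
    ω ![a, b + b'] = ω ![a, b] + ω ![a, b'] := by
  rw [apply_pair_swap ω (b + b') a, apply_pair_swap ω b a, apply_pair_swap ω b' a,
    apply_pair_add_left, neg_add]

/-- Homogeneity in the second slot. [folklore] -/
theorem apply_pair_smul_right (ω : E [⋀^Fin 2]→L[ℝ] F) (c : ℝ) (a b : E) :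
    ω ![a, c • b] = c • ω ![a, b] := by
  rw [apply_pair_swap ω (c • b) a, apply_pair_swap ω b a, apply_pair_smul_left, smul_neg]

/-- The bilinear map `(a, b) ↦ ω(a, b)` underlying a `2`-form, as a linear map in `a` valued in
linear maps in `b`. [folklore] -/
def pairingₗ (ω : E [⋀^Fin 2]→L[ℝ] F) : E →ₗ[ℝ] E →ₗ[ℝ] F :=
  LinearMap.mk₂ ℝ (fun a b => ω ![a, b]) (fun a a' b => apply_pair_add_left ω a a' b)
    (fun c a b => apply_pair_smul_left ω c a b) (fun a b b' => apply_pair_add_right ω a b b')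
    (fun c a b => apply_pair_smul_right ω c a b)

/-- Unfolding `pairingₗ`. [folklore] -/
@[simp] theorem pairingₗ_apply (ω : E [⋀^Fin 2]→L[ℝ] F) (a b : E) : pairingₗ ω a b = ω ![a, b] :=
  rfl

/-- The bound `‖ω(a, b)‖ ≤ ‖ω‖ ‖a‖ ‖b‖`. [folklore] -/
theorem norm_apply_pair_le (ω : E [⋀^Fin 2]→L[ℝ] F) (a b : E) : ‖ω ![a, b]‖ ≤ ‖ω‖ * ‖a‖ * ‖b‖ := by
  have h := ω.le_opNorm ![a, b]
  rw [Fin.prod_univ_two] at h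
  simpa [mul_assoc] using h

/-- **The real pairing of a complex-valued `2`-form**: `rePairing ω a b = Re ω(a, b)`, as a
continuous linear map `E →L[ℝ] (E →L[ℝ] ℝ)` (the real part of the interior product `a ↦ ι_a ω`).
[folklore] -/
def rePairing (ω : E [⋀^Fin 2]→L[ℝ] ℂ) : E →L[ℝ] E →L[ℝ] ℝ :=
  LinearMap.mkContinuous₂ ((pairingₗ ω).compr₂ Complex.reLm) ‖ω‖ fun a b => by
    simpa using (Complex.abs_re_le_norm _).trans (norm_apply_pair_le ω a b)

/-- **The imaginary pairing of a complex-valued `2`-form**: `imPairing ω a b = Im ω(a, b)`.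
[folklore] -/
def imPairing (ω : E [⋀^Fin 2]→L[ℝ] ℂ) : E →L[ℝ] E →L[ℝ] ℝ :=
  LinearMap.mkContinuous₂ ((pairingₗ ω).compr₂ Complex.imLm) ‖ω‖ fun a b => by
    simpa using (Complex.abs_im_le_norm _).trans (norm_apply_pair_le ω a b)

/-- Unfolding `rePairing`: `rePairing ω a b = Re ω(a, b)`. [folklore] -/
@[simp] theorem rePairing_apply (ω : E [⋀^Fin 2]→L[ℝ] ℂ) (a b : E) :
    rePairing ω a b = (ω ![a, b]).re := rfl

/-- Unfolding `imPairing`: `imPairing ω a b = Im ω(a, b)`. [folklore] -/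
@[simp] theorem imPairing_apply (ω : E [⋀^Fin 2]→L[ℝ] ℂ) (a b : E) :
    imPairing ω a b = (ω ![a, b]).im := rfl

/-- `Re ω(a, a) = 0`. [folklore] -/
theorem rePairing_apply_self (ω : E [⋀^Fin 2]→L[ℝ] ℂ) (a : E) : rePairing ω a a = 0 := by
  simp [apply_pair_self]

/-- `Re ω(b, a) = -Re ω(a, b)`. [folklore] -/
theorem rePairing_swap (ω : E [⋀^Fin 2]→L[ℝ] ℂ) (a b : E) : rePairing ω b a = -rePairing ω a b := by
  simp [apply_pair_swap ω a b]

/-- `Im ω(b, a) = -Im ω(a, b)`. [folklore] -/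
theorem imPairing_swap (ω : E [⋀^Fin 2]→L[ℝ] ℂ) (a b : E) : imPairing ω b a = -imPairing ω a b := by
  simp [apply_pair_swap ω a b]

/-- `‖rePairing ω‖ ≤ ‖ω‖`. [folklore] -/
theorem norm_rePairing_le (ω : E [⋀^Fin 2]→L[ℝ] ℂ) : ‖rePairing ω‖ ≤ ‖ω‖ :=
  LinearMap.mkContinuous₂_norm_le _ (norm_nonneg ω) _

/-- `‖imPairing ω‖ ≤ ‖ω‖`. [folklore] -/
theorem norm_imPairing_le (ω : E [⋀^Fin 2]→L[ℝ] ℂ) : ‖imPairing ω‖ ≤ ‖ω‖ :=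
  LinearMap.mkContinuous₂_norm_le _ (norm_nonneg ω) _

/-- **The real pairing depends continuously and linearly on the form** (norm `≤ 1`).
[folklore] -/
def rePairingL : (E [⋀^Fin 2]→L[ℝ] ℂ) →L[ℝ] (E →L[ℝ] E →L[ℝ] ℝ) :=
  LinearMap.mkContinuous
    { toFun := rePairing
      map_add' := fun ω ω' => by ext a b; simp
      map_smul' := fun c ω => by ext a b; simp } 1 fun ω => by
    simpa using norm_rePairing_le ω

/-- **The imaginary pairing depends continuously and linearly on the form.** [folklore] -/
def imPairingL : (E [⋀^Fin 2]→L[ℝ] ℂ) →L[ℝ] (E →L[ℝ] E →L[ℝ] ℝ) :=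
  LinearMap.mkContinuous
    { toFun := imPairing
      map_add' := fun ω ω' => by ext a b; simp
      map_smul' := fun c ω => by ext a b; simp } 1 fun ω => by
    simpa using norm_imPairing_le ω

/-- `rePairingL` is `rePairing` as a function. [folklore] -/
@[simp] theorem rePairingL_apply (ω : E [⋀^Fin 2]→L[ℝ] ℂ) : rePairingL ω = rePairing ω := rfl

/-- `imPairingL` is `imPairing` as a function. [folklore] -/
@[simp] theorem imPairingL_apply (ω : E [⋀^Fin 2]→L[ℝ] ℂ) : imPairingL ω = imPairing ω := rfl

/-- The real pairing is continuous in the form. [folklore] -/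
theorem continuous_rePairing : Continuous (rePairing : (E [⋀^Fin 2]→L[ℝ] ℂ) → E →L[ℝ] E →L[ℝ] ℝ) :=
  (rePairingL (E := E)).continuous

/-- The imaginary pairing is continuous in the form. [folklore] -/
theorem continuous_imPairing : Continuous (imPairing : (E [⋀^Fin 2]→L[ℝ] ℂ) → E →L[ℝ] E →L[ℝ] ℝ) :=
  (imPairingL (E := E)).continuous

/-- The pull-back of a `2`-form along `T`, evaluated on a pair. [folklore] -/
theorem compContinuousLinearMap_apply_pair (ω : E [⋀^Fin 2]→L[ℝ] F) (T : E →L[ℝ] E) (a b : E) :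
    ω.compContinuousLinearMap T ![a, b] = ω ![T a, T b] := by
  rw [ContinuousAlternatingMap.compContinuousLinearMap_apply]
  congr 1
  funext i; fin_cases i <;> rfl

/-- Change of variables: the real pairing of the pulled-back form `ω ∘ T`. [folklore] -/
theorem rePairing_compContinuousLinearMap (ω : E [⋀^Fin 2]→L[ℝ] ℂ) (T : E →L[ℝ] E) (a b : E) :
    rePairing (ω.compContinuousLinearMap T) a b = rePairing ω (T a) (T b) := by
  rw [rePairing_apply, rePairing_apply, compContinuousLinearMap_apply_pair]

/-- Change of variables for the imaginary pairing. [folklore] -/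
theorem imPairing_compContinuousLinearMap (ω : E [⋀^Fin 2]→L[ℝ] ℂ) (T : E →L[ℝ] E) (a b : E) :
    imPairing (ω.compContinuousLinearMap T) a b = imPairing ω (T a) (T b) := by
  rw [imPairing_apply, imPairing_apply, compContinuousLinearMap_apply_pair]

end Real

/-! ### Forms of type `(2,0)`: the real form underlying a `ℂ`-bilinear alternating form -/

section Complex

variable {E : Type*} [NormedAddCommGroup E] [NormedSpace ℂ E]

/-- `g(ia, b) = i g(a, b)` for a `ℂ`-bilinear `g`. [folklore] -/
theorem apply_pair_I_smul_left (g : E [⋀^Fin 2]→L[ℂ] ℂ) (a b : E) :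
    g ![Complex.I • a, b] = Complex.I * g ![a, b] :=
  g.vecCons_smul ![b] Complex.I a

/-- `g(b, a) = -g(a, b)` for a `ℂ`-bilinear `g`. [folklore] -/
theorem apply_pair_swap_complex (g : E [⋀^Fin 2]→L[ℂ] ℂ) (a b : E) : g ![b, a] = -g ![a, b] := by
  have := apply_pair_swap (g.restrictScalars ℝ) a b
  simpa only [ContinuousAlternatingMap.coe_restrictScalars] using this

/-- `g(a, a) = 0` for a `ℂ`-bilinear `g`. [folklore] -/
theorem apply_pair_self_complex (g : E [⋀^Fin 2]→L[ℂ] ℂ) (a : E) : g ![a, a] = 0 := by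
  have := apply_pair_self (g.restrictScalars ℝ) a
  simpa only [ContinuousAlternatingMap.coe_restrictScalars] using this

/-- `g(a, ib) = i g(a, b)` for a `ℂ`-bilinear `g`. [folklore] -/
theorem apply_pair_I_smul_right (g : E [⋀^Fin 2]→L[ℂ] ℂ) (a b : E) :
    g ![a, Complex.I • b] = Complex.I * g ![a, b] := by
  rw [apply_pair_swap_complex g (Complex.I • b) a, apply_pair_I_smul_left,
    apply_pair_swap_complex g b a, mul_neg]

/-- Additivity in the first slot, complex form. [folklore] -/
theorem apply_pair_add_left_complex (g : E [⋀^Fin 2]→L[ℂ] ℂ) (a a' b : E) :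
    g ![a + a', b] = g ![a, b] + g ![a', b] :=
  g.vecCons_add ![b] a a'

/-- `ℂ`-homogeneity in the first slot. [folklore] -/
theorem apply_pair_smul_left_complex (g : E [⋀^Fin 2]→L[ℂ] ℂ) (z : ℂ) (a b : E) :
    g ![z • a, b] = z * g ![a, b] :=
  g.vecCons_smul ![b] z a

/-- `Re g(ia, b) = -Im g(a, b)` for a `ℂ`-bilinear `g`. [folklore] -/
theorem rePairing_restrictScalars_I_smul (g : E [⋀^Fin 2]→L[ℂ] ℂ) (a b : E) :
    rePairing (g.restrictScalars ℝ) (Complex.I • a) b = -imPairing (g.restrictScalars ℝ) a b := by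
  simp only [rePairing_apply, imPairing_apply, ContinuousAlternatingMap.coe_restrictScalars,
    apply_pair_I_smul_left, Complex.I_mul_re]

/-- `Im g(ia, b) = Re g(a, b)` for a `ℂ`-bilinear `g`. [folklore] -/
theorem imPairing_restrictScalars_I_smul (g : E [⋀^Fin 2]→L[ℂ] ℂ) (a b : E) :
    imPairing (g.restrictScalars ℝ) (Complex.I • a) b = rePairing (g.restrictScalars ℝ) a b := by
  simp only [rePairing_apply, imPairing_apply, ContinuousAlternatingMap.coe_restrictScalars,
    apply_pair_I_smul_left, Complex.I_mul_im]

/-- `Re g(a, ib) = -Im g(a, b)` for a `ℂ`-bilinear `g`. [folklore] -/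
theorem rePairing_restrictScalars_I_smul_right (g : E [⋀^Fin 2]→L[ℂ] ℂ) (a b : E) :
    rePairing (g.restrictScalars ℝ) a (Complex.I • b) = -imPairing (g.restrictScalars ℝ) a b := by
  simp only [rePairing_apply, imPairing_apply, ContinuousAlternatingMap.coe_restrictScalars,
    apply_pair_I_smul_right, Complex.I_mul_re]

/-- `Im g(a, ib) = Re g(a, b)` for a `ℂ`-bilinear `g`. [folklore] -/
theorem imPairing_restrictScalars_I_smul_right (g : E [⋀^Fin 2]→L[ℂ] ℂ) (a b : E) :
    imPairing (g.restrictScalars ℝ) a (Complex.I • b) = rePairing (g.restrictScalars ℝ) a b := by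
  simp only [rePairing_apply, imPairing_apply, ContinuousAlternatingMap.coe_restrictScalars,
    apply_pair_I_smul_right, Complex.I_mul_im]

/-- **A non-zero `ℂ`-bilinear alternating `2`-form on a complex plane is non-degenerate**
(`Λ²(ℂ²)^*` is one-dimensional): if `dim_ℂ E = 2`, `g ≠ 0` and `a ≠ 0`, then `g(a, b) ≠ 0` for
some `b`. Proof: extend `a` to a basis `(a, b₀)`; if `g(a, ·) = 0` then `g` vanishes on all pairs
of basis vectors, hence `g = 0`. [cite: Huybrechts2016K3, Ch. 3 §1] -/
theorem apply_ne_zero_of_finrank_eq_two [FiniteDimensional ℂ E] (h2 : finrank ℂ E = 2)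
    {g : E [⋀^Fin 2]→L[ℂ] ℂ} (hg : g ≠ 0) {a : E} (ha : a ≠ 0) : ∃ b : E, g ![a, b] ≠ 0 := by
  by_contra hall
  push Not at hall
  apply hg
  -- extend `a` to a basis `(a, b₀)` of the plane `E`
  obtain ⟨b₀, hb₀⟩ : ∃ b₀ : E, LinearIndependent ℂ ![a, b₀] := by
    have hspan : (Submodule.span ℂ ({a} : Set E)) ≠ ⊤ := by
      intro htop
      have h1 : finrank ℂ (Submodule.span ℂ ({a} : Set E)) ≤ 1 := by
        simpa using finrank_span_le_card ({a} : Set E)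
      rw [htop, finrank_top, h2] at h1
      omega
    obtain ⟨b₀, hb₀⟩ : ∃ b₀ : E, b₀ ∉ Submodule.span ℂ ({a} : Set E) := by
      by_contra h; push Not at h
      exact hspan (Submodule.eq_top_iff'.2 h)
    refine ⟨b₀, (LinearIndependent.pair_iff' ha).2 fun c hc => hb₀ ?_⟩
    rw [← hc]
    exact Submodule.smul_mem _ _ (Submodule.subset_span rfl)
  -- `(a, b₀)` is a basis since `dim E = 2`
  have hcard : Fintype.card (Fin 2) = finrank ℂ E := by simp [h2]
  let B : Basis (Fin 2) ℂ E := basisOfLinearIndependentOfCardEqFinrank hb₀ hcard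
  have hB : ⇑B = ![a, b₀] := coe_basisOfLinearIndependentOfCardEqFinrank hb₀ hcard
  -- `g` vanishes on all pairs of basis vectors
  have hvan : ∀ i j : Fin 2, g ![B i, B j] = 0 := by
    intro i j
    fin_cases i <;> fin_cases j
    · simpa [hB] using apply_pair_self_complex g a
    · simpa [hB] using hall b₀
    · simpa [hB, apply_pair_swap_complex g a b₀] using hall b₀
    · simpa [hB] using apply_pair_self_complex g b₀
  -- hence `g = 0` (multilinear maps are determined by their values on a basis)
  have hzero : g.toContinuousMultilinearMap.toMultilinearMap =
      (0 : E [⋀^Fin 2]→L[ℂ] ℂ).toContinuousMultilinearMap.toMultilinearMap := by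
    refine Basis.ext_multilinear (fun _ : Fin 2 => B) fun v => ?_
    have hv : (fun i => B (v i)) = ![B (v 0), B (v 1)] := by funext i; fin_cases i <;> rfl
    change g (fun i => B (v i)) = (0 : E [⋀^Fin 2]→L[ℂ] ℂ) (fun i => B (v i))
    rw [hv, hvan]
    rfl
  ext v
  exact congrArg (fun f : MultilinearMap ℂ (fun _ : Fin 2 => E) ℂ => f v) hzero

variable [FiniteDimensional ℂ E]

/-- **The real pairing of a non-zero `(2,0)`-form on a complex plane is injective**: if
`Re g(a, b) = 0` for all `b` then also `Re g(a, ib) = -Im g(a, b) = 0`, so `g(a, ·) = 0` and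
`a = 0` by non-degeneracy. [cite: Huybrechts2016K3, Ch. 3 §1] -/
theorem injective_rePairing_restrictScalars (h2 : finrank ℂ E = 2) {g : E [⋀^Fin 2]→L[ℂ] ℂ}
    (hg : g ≠ 0) : Function.Injective (rePairing (g.restrictScalars ℝ)) := by
  refine (injective_iff_map_eq_zero _).2 fun a ha => ?_
  by_contra hane
  obtain ⟨b, hb⟩ := apply_ne_zero_of_finrank_eq_two h2 hg hane
  apply hb
  apply Complex.ext
  · have h := congrArg (fun φ : E →L[ℝ] ℝ => φ b) ha
    simpa using h
  · have h := congrArg (fun φ : E →L[ℝ] ℝ => φ (Complex.I • b)) ha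
    simp only [rePairing_restrictScalars_I_smul_right, imPairing_apply,
      ContinuousAlternatingMap.coe_restrictScalars] at h
    simpa using h

/-- **The real pairing of a non-zero `(2,0)`-form on a complex plane is invertible**
(`E → E^*` injective between real vector spaces of the same finite dimension): every real
covector is `Re g(v, ·)` for a unique `v`. [cite: Huybrechts2016K3, Ch. 3 §1] -/
theorem isInvertible_rePairing_restrictScalars (h2 : finrank ℂ E = 2) {g : E [⋀^Fin 2]→L[ℂ] ℂ}
    (hg : g ≠ 0) : (rePairing (g.restrictScalars ℝ)).IsInvertible := by
  set Φ := rePairing (g.restrictScalars ℝ) with hΦ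
  have hinj : Function.Injective Φ := injective_rePairing_restrictScalars h2 hg
  -- `dim_ℝ E = dim_ℝ (E →L[ℝ] ℝ)`
  have hdim : finrank ℝ E = finrank ℝ (E →L[ℝ] ℝ) := by
    rw [LinearEquiv.finrank_eq (LinearMap.toContinuousLinearMap : (E →ₗ[ℝ] ℝ) ≃ₗ[ℝ] E →L[ℝ] ℝ).symm]
    exact (Subspace.dual_finrank_eq (K := ℝ) (V := E)).symm
  have hbij : Function.Bijective Φ :=
    ⟨hinj, (LinearMap.injective_iff_surjective_of_finrank_eq_finrank hdim).1 hinj⟩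
  let e : E ≃L[ℝ] (E →L[ℝ] ℝ) :=
    (LinearEquiv.ofBijective Φ.toLinearMap hbij).toContinuousLinearEquiv
  exact ⟨e, by ext a b; rfl⟩

/-- **The `g`-dual vector of a real covector**: for a non-zero `(2,0)`-form `g` on a complex plane
and `l : E →L[ℝ] ℝ`, the vector `v = (rePairing g|_ℝ)⁻¹ l` satisfies `Re g(v, b) = l b` for all
`b`. [cite: Huybrechts2016K3, Ch. 3 §1] -/
theorem rePairing_inverse_apply (h2 : finrank ℂ E = 2) {g : E [⋀^Fin 2]→L[ℂ] ℂ} (hg : g ≠ 0)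
    (l : E →L[ℝ] ℝ) :
    rePairing (g.restrictScalars ℝ) ((rePairing (g.restrictScalars ℝ)).inverse l) = l := by
  obtain ⟨e, he⟩ := isInvertible_rePairing_restrictScalars h2 hg
  rw [← he, ContinuousLinearMap.inverse_equiv]
  simp

/-- The `g`-dual of `l` vanishes iff `l = 0`. [folklore] -/
theorem rePairing_inverse_eq_zero_iff (h2 : finrank ℂ E = 2) {g : E [⋀^Fin 2]→L[ℂ] ℂ} (hg : g ≠ 0)
    (l : E →L[ℝ] ℝ) : (rePairing (g.restrictScalars ℝ)).inverse l = 0 ↔ l = 0 := by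
  obtain ⟨e, he⟩ := isInvertible_rePairing_restrictScalars h2 hg
  rw [← he, ContinuousLinearMap.inverse_equiv]
  simp

/-- **The `g`-dual of `-Im g(a, ·)` is `ia`**: `Re g(ia, b) = -Im g(a, b)` for all `b`
(multiplication by `i` on vectors, expressed through the pairings alone). [folklore] -/
theorem rePairing_inverse_neg_imPairing (h2 : finrank ℂ E = 2) {g : E [⋀^Fin 2]→L[ℂ] ℂ}
    (hg : g ≠ 0) (a : E) :
    (rePairing (g.restrictScalars ℝ)).inverse (-imPairing (g.restrictScalars ℝ) a) = Complex.I • a := by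
  apply injective_rePairing_restrictScalars h2 hg
  rw [rePairing_inverse_apply h2 hg]
  ext b
  show -(imPairing (g.restrictScalars ℝ) a b) = rePairing (g.restrictScalars ℝ) (Complex.I • a) b
  rw [rePairing_restrictScalars_I_smul]

omit [FiniteDimensional ℂ E] in
/-- **Four vectors `a, ia, b, ib` with `g(a, b) ≠ 0` are linearly independent over `ℝ`**
(pair `Σ cₖ vₖ = 0` against `g(·, b)` and `g(·, a)`: `(c₀ + i c₁) g(a, b) = 0` and
`(c₂ + i c₃) g(b, a) = 0`). This is the pointwise independence of the almost-framing of a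
holomorphic symplectic surface. [folklore] -/
theorem linearIndependent_of_apply_pair_ne_zero (g : E [⋀^Fin 2]→L[ℂ] ℂ) {a b : E}
    (hab : g ![a, b] ≠ 0) :
    LinearIndependent ℝ ![a, Complex.I • a, b, Complex.I • b] := by
  rw [Fintype.linearIndependent_iff]
  intro c hc
  -- rewrite the real combination as `α • a + β • b` with complex coefficients
  have key : ((c 0 : ℂ) + (c 1 : ℂ) * Complex.I) • a + ((c 2 : ℂ) + (c 3 : ℂ) * Complex.I) • b = 0 := by
    have h : ∑ i, c i • (![a, Complex.I • a, b, Complex.I • b] i) = 0 := hc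
    rw [Fin.sum_univ_four] at h
    simp only [Matrix.cons_val_zero, Matrix.cons_val_one, Matrix.cons_val] at h
    rw [add_smul, add_smul, mul_smul, mul_smul, Complex.coe_smul, Complex.coe_smul,
      Complex.coe_smul, Complex.coe_smul]
    calc (c 0 • a + c 1 • Complex.I • a) + (c 2 • b + c 3 • Complex.I • b)
        = c 0 • a + c 1 • Complex.I • a + c 2 • b + c 3 • Complex.I • b := by abel
      _ = 0 := h
  -- pair with `g(·, b)`: `α g(a, b) = 0`
  have h1 : ((c 0 : ℂ) + (c 1 : ℂ) * Complex.I) * g ![a, b] = 0 := by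
    have h : g ![((c 0 : ℂ) + (c 1 : ℂ) * Complex.I) • a + ((c 2 : ℂ) + (c 3 : ℂ) * Complex.I) • b, b] =
        g ![(0 : E), b] := congrArg (fun v => g ![v, b]) key
    rw [apply_pair_add_left_complex, apply_pair_smul_left_complex, apply_pair_smul_left_complex,
      apply_pair_self_complex, mul_zero, add_zero,
      g.map_coord_zero (m := ![(0 : E), b]) 0 rfl] at h
    exact h
  -- pair with `g(·, a)`: `β g(b, a) = 0`
  have h2 : ((c 2 : ℂ) + (c 3 : ℂ) * Complex.I) * g ![a, b] = 0 := by
    have h : g ![((c 0 : ℂ) + (c 1 : ℂ) * Complex.I) • a + ((c 2 : ℂ) + (c 3 : ℂ) * Complex.I) • b, a] =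
        g ![(0 : E), a] := congrArg (fun v => g ![v, a]) key
    rw [apply_pair_add_left_complex, apply_pair_smul_left_complex, apply_pair_smul_left_complex,
      apply_pair_self_complex, mul_zero, zero_add, apply_pair_swap_complex g a b, mul_neg,
      g.map_coord_zero (m := ![(0 : E), a]) 0 rfl, neg_eq_zero] at h
    exact h
  have hα0 : (c 0 : ℂ) + (c 1 : ℂ) * Complex.I = 0 := (mul_eq_zero.1 h1).resolve_right hab
  have hβ0 : (c 2 : ℂ) + (c 3 : ℂ) * Complex.I = 0 := (mul_eq_zero.1 h2).resolve_right hab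
  have e0 : c 0 = 0 := by simpa using congrArg Complex.re hα0
  have e1 : c 1 = 0 := by simpa using congrArg Complex.im hα0
  have e2 : c 2 = 0 := by simpa using congrArg Complex.re hβ0
  have e3 : c 3 = 0 := by simpa using congrArg Complex.im hβ0
  intro i
  fin_cases i
  · exact e0
  · exact e1
  · exact e2
  · exact e3

end Complex

end Literature.Geometry.Kaehler

end
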